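import Summits.ResolutionOfSingularities.ResolutionOfSingularities.Theorems.RadicialJungCleanModelsPBasisAtClosedPoint
import Literature.AlgebraicGeometry.Resolution.ResolutionOfSingularities
import Mathlib.AlgebraicGeometry.Morphisms.FiniteType
import Mathlib.RingTheory.Jacobson.Ring
import HarnessLib

/-!
# Route `RadicialJung`, crux `CleanModels` (stmt-15917): A `p`-BASIS OF THE STALK AT A CLOSED POINT
# CONTAINING A PRESCRIBED REGULAR SYSTEM OF PARAMETERS — stalk form of the T2 `p`-basis discharge

Support file (OURS) for PROGRAMME-clean-dim2 / T2 (`HOME/L/res-L0-w81-pv-2/g5/T2-ARCHITECTURE.md`).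
For a regular scheme `X` locally of finite type over a field `k` of characteristic `p`, a CLOSED
point `ξ` and a regular system of parameters `x` of `𝒪_{X,ξ}`, there is a `p`-basis `Γ ∋ x_1, …, x_d`
of `𝒪_{X,ξ}` over `𝒪_{X,ξ}^p` (`exists_isPBasisOver_stalk`) — the input of `giraud_exactness` and of
the B7 read-off, from `exists_isPBasisOver_containing_rsop`: `𝒪_{X,ξ}` is the localisation of the
finitely generated `k`-algebra `Γ(X, U)` at a maximal ideal (so it is ring-generated by its `p`-th
powers, `k` and the generators: `a/b = a b^{p-1} (1/b)^p`), and its residue field `Γ(X,U)/𝔮` is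
finite over `k` (Zariski's lemma). [cite: KimuraNiitsuma1980, Thm. 3.4]
-/

noncomputable section

open CategoryTheory AlgebraicGeometry TopologicalSpace IsLocalRing Opposite
open Literature.AlgebraicGeometry.Resolution Literature.RingTheory.PBasis

namespace Summit.ResolutionOfSingularities.ResolutionOfSingularities.Theorems.RadicialJung.CleanModels

/-- **A `p`-basis of `𝒪_{X,ξ}` over `𝒪_{X,ξ}^p` containing a prescribed regular system of parameters**,
at a closed point `ξ` of a regular scheme locally of finite type over a field of characteristic
`p` (Kimura–Niitsuma 1980, Thm. 3.4 with Lemma 2.6, consumer-shaped). [cite: KimuraNiitsuma1980, Thm. 3.4] -/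
theorem exists_isPBasisOver_stalk (p : ℕ) [Fact p.Prime] (k : Type) [Field k] [CharP k p]
    {X : Scheme.{0}} (q : X ⟶ Spec (.of k)) [LocallyOfFiniteType q] (hreg : Scheme.IsRegular X)
    {ξ : X} (hξ : IsClosed ({ξ} : Set X)) [CharP (X.presheaf.stalk ξ) p]
    {d : ℕ} (x : Fin d → X.presheaf.stalk ξ)
    (hx : Ideal.span (Set.range x) = maximalIdeal (X.presheaf.stalk ξ))
    (hd : ringKrullDim (X.presheaf.stalk ξ) = d) :
    ∃ Γ : Set (X.presheaf.stalk ξ), Set.range x ⊆ Γ ∧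
      IsPBasisOver p (frobenius (X.presheaf.stalk ξ) p).range Γ := by
  classical
  have hp : p.Prime := Fact.out
  haveI : IsRegularLocalRing (X.presheaf.stalk ξ) := hreg ξ
  -- an affine open `U ∋ ξ`; `A = Γ(X, U)` is of finite type over `k`
  obtain ⟨U, hU, hξU, -⟩ :=
    exists_isAffineOpen_mem_and_subset (X := X) (x := ξ) (U := ⊤) (Opens.mem_top ξ)
  let ψ : k →+* Γ(X, U) := (q.appLE ⊤ U le_top).hom.comp (Scheme.ΓSpecIso (.of k)).inv.hom
  have hψ : ψ.FiniteType := by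
    refine RingHom.FiniteType.comp ?_ (RingHom.FiniteType.of_surjective _
      (Scheme.ΓSpecIso (.of k)).symm.commRingCatIsoToRingEquiv.surjective)
    exact HasRingHomProperty.appLE @LocallyOfFiniteType q ‹_› ⟨⊤, isAffineOpen_top _⟩ ⟨U, hU⟩ le_top
  letI : Algebra k Γ(X, U) := ψ.toAlgebra
  haveI hft : Algebra.FiniteType k Γ(X, U) := hψ
  -- the stalk as the localisation at the maximal ideal `𝔮` of `ξ`
  letI := TopCat.Presheaf.algebra_section_stalk X.presheaf (⟨ξ, hξU⟩ : U)
  haveI := hU.isLocalization_stalk ⟨ξ, hξU⟩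
  haveI h𝔮 : (hU.primeIdealOf ⟨ξ, hξU⟩).asIdeal.IsMaximal :=
    hU.primeIdealOf_isMaximal_of_isClosed ⟨ξ, hξU⟩ hξ
  let φ : k →+* X.presheaf.stalk ξ := (algebraMap Γ(X, U) (X.presheaf.stalk ξ)).comp ψ
  letI : Algebra k (X.presheaf.stalk ξ) := φ.toAlgebra
  have hφ : ∀ c : k, algebraMap k (X.presheaf.stalk ξ) c =
      algebraMap Γ(X, U) (X.presheaf.stalk ξ) (algebraMap k Γ(X, U) c) := fun _ => rfl
  -- (hgen) ring generation by `p`-th powers, `k` and the algebra generators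
  obtain ⟨t, ht⟩ := hft.out
  have hgen : ∃ s : Finset (X.presheaf.stalk ξ), Subring.closure
      (Set.range (frobenius (X.presheaf.stalk ξ) p) ∪ Set.range (algebraMap k (X.presheaf.stalk ξ)) ∪
        ↑s) = ⊤ := by
    refine ⟨t.image (algebraMap Γ(X, U) (X.presheaf.stalk ξ)), ?_⟩
    set C := Subring.closure
      (Set.range (frobenius (X.presheaf.stalk ξ) p) ∪ Set.range (algebraMap k (X.presheaf.stalk ξ)) ∪
        ↑(t.image (algebraMap Γ(X, U) (X.presheaf.stalk ξ)))) with hC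
    have hA : ∀ a : Γ(X, U), algebraMap Γ(X, U) (X.presheaf.stalk ξ) a ∈ C := by
      intro a
      have ha : a ∈ (Algebra.adjoin k (t : Set Γ(X, U))).toSubring := by
        rw [ht, Algebra.top_toSubring]; exact Subring.mem_top a
      rw [Algebra.adjoin_eq_ring_closure] at ha
      have ha' : algebraMap Γ(X, U) (X.presheaf.stalk ξ) a ∈
          (Subring.closure (Set.range (algebraMap k Γ(X, U)) ∪ ↑t)).map
            (algebraMap Γ(X, U) (X.presheaf.stalk ξ)) := ⟨a, ha, rfl⟩
      rw [RingHom.map_closure] at ha'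
      refine (Subring.closure_le.mpr ?_) ha'
      rintro _ ⟨a', ha'', rfl⟩
      rcases ha'' with ⟨c, rfl⟩ | ha''
      · exact Subring.subset_closure (Or.inl (Or.inr ⟨c, hφ c⟩))
      · exact Subring.subset_closure (Or.inr (Finset.mem_coe.mpr (Finset.mem_image_of_mem _ ha'')))
    have hCpow : ∀ r : X.presheaf.stalk ξ, r ^ p ∈ C := fun r =>
      Subring.subset_closure (Or.inl (Or.inl ⟨r, frobenius_def _ _⟩))
    rw [eq_top_iff]
    rintro z -
    obtain ⟨a, b, rfl⟩ := IsLocalization.exists_mk'_eq (hU.primeIdealOf ⟨ξ, hξU⟩).asIdeal.primeCompl z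
    obtain ⟨u, hu⟩ := IsLocalization.map_units (X.presheaf.stalk ξ) b
    have hz : IsLocalization.mk' (X.presheaf.stalk ξ) a b =
        algebraMap Γ(X, U) (X.presheaf.stalk ξ) a * ((u⁻¹ : (X.presheaf.stalk ξ)ˣ) : X.presheaf.stalk ξ) := by
      rw [Units.eq_mul_inv_iff_mul_eq, hu]
      exact IsLocalization.mk'_spec _ a b
    rw [hz]
    refine C.mul_mem (hA a) (units_inv_mem_subring_of_pow_mem hp.one_lt.le C hCpow u ?_)
    rw [hu]; exact hA _
  -- (hfin) the residue field is finite over `k` (Zariski's lemma for `Γ(X,U)/𝔮`)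
  have hfin : ∃ (n : ℕ) (e : Fin n → ResidueField (X.presheaf.stalk ξ)), ∀ z, ∃ c : Fin n → k,
      z = ∑ i, residue (X.presheaf.stalk ξ) (algebraMap k (X.presheaf.stalk ξ) (c i)) * e i := by
    let 𝔮 := (hU.primeIdealOf ⟨ξ, hξU⟩).asIdeal
    letI : Field (Γ(X, U) ⧸ 𝔮) := Ideal.Quotient.field 𝔮
    haveI : Algebra.FiniteType k (Γ(X, U) ⧸ 𝔮) := inferInstance
    haveI : Module.Finite k (Γ(X, U) ⧸ 𝔮) := finite_of_finite_type_of_isJacobsonRing k _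
    obtain ⟨n, e₀, he₀⟩ := Module.Finite.exists_fin (R := k) (M := Γ(X, U) ⧸ 𝔮)
    let E := IsLocalization.AtPrime.equivQuotMaximalIdeal 𝔮 (X.presheaf.stalk ξ)
    have hE : ∀ c : k, E (algebraMap k (Γ(X, U) ⧸ 𝔮) c) =
        residue (X.presheaf.stalk ξ) (algebraMap k (X.presheaf.stalk ξ) c) := by
      intro c
      rw [← Ideal.Quotient.mk_algebraMap, IsLocalization.AtPrime.equivQuotMaximalIdeal_apply_mk, hφ]
      rfl
    refine ⟨n, fun i => E (e₀ i), fun z => ?_⟩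
    obtain ⟨c, hc⟩ := (Submodule.mem_span_range_iff_exists_fun k).mp
      (show E.symm z ∈ Submodule.span k (Set.range e₀) by rw [he₀]; exact Submodule.mem_top)
    refine ⟨c, ?_⟩
    have hz : z = E (E.symm z) := (E.apply_symm_apply z).symm
    rw [hz, ← hc, map_sum]
    refine Finset.sum_congr rfl fun i _ => ?_
    rw [Algebra.smul_def, map_mul, hE]
    rfl
  exact exists_isPBasisOver_containing_rsop p hgen hfin x hx hd

end Summit.ResolutionOfSingularities.ResolutionOfSingularities.Theorems.RadicialJung.CleanModels
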